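import Mathlib
import Summits.Ventures.PercRepro.TriangleCapC047Refutation

/-!
# PercRepro — the true cherry bound on triangle-free graphs (Mantel's degree-sum lemma), and its sharpness
on the complete bipartite graphs that killed ROW C-047 (p3, gen 28)

ROW C-047 (TriangleCapC047Refutation) claimed `Σ_v C(d_D(v), 2) ≤ B_k(m)` for every `K₄⁻`-free graph `D`
on `k` vertices with `m` edges; it dies on `K_{3,25}` (`975 > 974`).  This module records in the kernel what the
truth is on the triangle-free sub-class, the classical degree-sum step of Mantel's theorem (Mantel 1907;
Jukna, *Extremal Combinatorics* 2011, Thm 4.6, second proof, p. 50):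

* `deg_add_deg_le_of_adj` — in a triangle-free graph two adjacent vertices have disjoint neighbourhoods, so
  `d(v) + d(w) ≤ k`;
* `sum_deg_mul_deg_le` — `Σ_v d(v)² = Σ_{(v,w) adjacent, ordered} d(v) ≤ m·k` (the ordered adjacent pairs
  `adjPairsAll`, counted twice by the swap `(v,w) ↦ (w,v)`);
* **`mantel_cherries`** — `2·Σ_v C(d(v), 2) + 2m ≤ m·k`, i.e. `Σ_v C(d(v), 2) ≤ m(k−2)/2`
  (`cherries_le_of_cliqueFree`, for `k ≥ 2`), for every triangle-free `D`;
* **`mantel_eq_bip`** — equality on every complete bipartite graph `K_{a, n−a}` (`cliqueFree_bip`):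
  `2·cherries + 2m = m·n` — so the complete bipartite graphs are extremal for the triangle-free problem, and
  a bound of the row's shape below `m(k−2)/2` at `m = a(k−a)` (as `B₂₈(75) = 974 < 975 = 75·26/2`) is
  false already on triangle-free graphs.

No claim is made about the exact `K₄⁻`-free maximum; the lane leaves it open (P3-TRIANGLE-CAP.md §10x).
Axioms: standard.
-/

namespace PercRepro

namespace TriangleCap

namespace C047

open Finset

variable {V : Type*} [Fintype V] [DecidableEq V]

/-- All ordered adjacent pairs `(v, w)` with `v ~ w` (each edge counted twice). -/
def adjPairsAll (D : SimpleGraph V) [DecidableRel D.Adj] : Finset (V × V) :=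
  (univ ×ˢ univ).filter (fun p => D.Adj p.1 p.2)

omit [DecidableEq V] in
/-- A sum over the ordered adjacent pairs of a function of the first coordinate is weighted by the degree. -/
theorem sum_fst_adjPairsAll (D : SimpleGraph V) [DecidableRel D.Adj] (f : V → ℕ) :
    ∑ p ∈ adjPairsAll D, f p.1 = ∑ v, deg D v * f v := by
  unfold adjPairsAll
  rw [sum_filter, sum_product]
  apply sum_congr rfl
  intro v _
  rw [← sum_filter]
  show ∑ a ∈ univ.filter (fun a => D.Adj v a), f v = deg D v * f v
  rw [sum_const, smul_eq_mul]
  rfl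

omit [DecidableEq V] in
/-- The swap `(v, w) ↦ (w, v)` preserves the ordered adjacent pairs. -/
theorem sum_snd_adjPairsAll (D : SimpleGraph V) [DecidableRel D.Adj] (f : V → ℕ) :
    ∑ p ∈ adjPairsAll D, f p.2 = ∑ p ∈ adjPairsAll D, f p.1 := by
  apply sum_nbij' Prod.swap Prod.swap
  · intro p hp
    simp only [adjPairsAll, mem_filter, mem_product, mem_univ, true_and, Prod.fst_swap,
      Prod.snd_swap] at hp ⊢
    exact hp.symm
  · intro p hp
    simp only [adjPairsAll, mem_filter, mem_product, mem_univ, true_and, Prod.fst_swap,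
      Prod.snd_swap] at hp ⊢
    exact hp.symm
  · intro p _
    exact Prod.swap_swap p
  · intro p _
    exact Prod.swap_swap p
  · intro p _
    rfl

omit [DecidableEq V] in
/-- `Σ_v d(v) = 2m`. -/
theorem sum_deg_eq (D : SimpleGraph V) [DecidableRel D.Adj] :
    ∑ v, deg D v = 2 * D.edgeFinset.card := by
  rw [← D.sum_degrees_eq_twice_card_edges]
  exact sum_congr rfl (fun v _ => deg_eq_degree D v)

omit [DecidableEq V] in
/-- There are `Σ_v d(v) = 2m` ordered adjacent pairs. -/
theorem card_adjPairsAll (D : SimpleGraph V) [DecidableRel D.Adj] :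
    (adjPairsAll D).card = 2 * D.edgeFinset.card := by
  rw [card_eq_sum_ones, sum_fst_adjPairsAll D (fun _ => 1), ← sum_deg_eq]
  simp only [mul_one]

/-- In a triangle-free graph adjacent vertices have disjoint neighbourhoods: `d(v) + d(w) ≤ k`. -/
theorem deg_add_deg_le_of_adj (D : SimpleGraph V) [DecidableRel D.Adj] (hfree : D.CliqueFree 3)
    {v w : V} (h : D.Adj v w) : deg D v + deg D w ≤ Fintype.card V := by
  have hdisj : Disjoint (univ.filter (fun x => D.Adj v x)) (univ.filter (fun x => D.Adj w x)) := by
    rw [Finset.disjoint_left]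
    intro x hx hx'
    rw [mem_filter] at hx hx'
    exact hfree {v, w, x} (SimpleGraph.is3Clique_triple_iff.mpr ⟨h, hx.2, hx'.2⟩)
  unfold deg
  rw [← card_union_of_disjoint hdisj]
  exact card_le_univ _

/-- **Mantel's degree-sum lemma:** `Σ_v d(v)² ≤ m·k` for a triangle-free graph on `k` vertices with `m` edges. -/
theorem sum_deg_mul_deg_le (D : SimpleGraph V) [DecidableRel D.Adj] (hfree : D.CliqueFree 3) :
    ∑ v, deg D v * deg D v ≤ D.edgeFinset.card * Fintype.card V := by
  have h1 : ∑ p ∈ adjPairsAll D, (deg D p.1 + deg D p.2) = 2 * ∑ v, deg D v * deg D v := by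
    rw [sum_add_distrib, sum_snd_adjPairsAll, sum_fst_adjPairsAll]
    ring
  have h2 : ∑ p ∈ adjPairsAll D, (deg D p.1 + deg D p.2) ≤ ∑ p ∈ adjPairsAll D, Fintype.card V :=
    sum_le_sum (fun p hp => deg_add_deg_le_of_adj D hfree (mem_filter.mp hp).2)
  rw [sum_const, smul_eq_mul, card_adjPairsAll, h1, mul_assoc] at h2
  exact Nat.le_of_mul_le_mul_left h2 (by norm_num)

/-- `2·C(d, 2) + d = d²`. -/
theorem two_mul_choose_two_add (d : ℕ) : 2 * d.choose 2 + d = d * d := by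
  rw [Nat.choose_two_right, Nat.mul_div_cancel' (Nat.even_mul_pred_self d).two_dvd]
  cases d with
  | zero => rfl
  | succ d => rw [Nat.add_sub_cancel]; ring

omit [DecidableEq V] in
/-- `2·cherries(D) + Σ_v d(v) = Σ_v d(v)²`. -/
theorem two_mul_cherries_add (D : SimpleGraph V) [DecidableRel D.Adj] :
    2 * cherries D + ∑ v, deg D v = ∑ v, deg D v * deg D v := by
  unfold cherries
  rw [mul_sum, ← sum_add_distrib]
  exact sum_congr rfl (fun v _ => two_mul_choose_two_add (deg D v))

/-- **THE TRUE CHERRY BOUND ON TRIANGLE-FREE GRAPHS:** `2·Σ_v C(d(v), 2) + 2m ≤ m·k`. -/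
theorem mantel_cherries (D : SimpleGraph V) [DecidableRel D.Adj] (hfree : D.CliqueFree 3) :
    2 * cherries D + 2 * D.edgeFinset.card ≤ D.edgeFinset.card * Fintype.card V := by
  have h := sum_deg_mul_deg_le D hfree
  rw [← two_mul_cherries_add, sum_deg_eq] at h
  exact h

/-- `Σ_v C(d(v), 2) ≤ m(k−2)/2` for a triangle-free graph on `k ≥ 2` vertices. -/
theorem cherries_le_of_cliqueFree (D : SimpleGraph V) [DecidableRel D.Adj] (hfree : D.CliqueFree 3)
    (hk : 2 ≤ Fintype.card V) :
    cherries D ≤ D.edgeFinset.card * (Fintype.card V - 2) / 2 := by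
  have h := mantel_cherries D hfree
  obtain ⟨k, hk'⟩ := Nat.exists_eq_add_of_le hk
  rw [hk'] at h ⊢
  rw [Nat.add_sub_cancel_left, Nat.le_div_iff_mul_le (by norm_num)]
  nlinarith [h]

/-- Complete bipartite graphs are triangle-free. -/
theorem cliqueFree_bip (n a : ℕ) : (bip n a).CliqueFree 3 := by
  intro S hS
  rw [SimpleGraph.is3Clique_iff] at hS
  obtain ⟨x, y, z, hxy, hxz, hyz, -⟩ := hS
  rw [bip_adj] at hxy hxz hyz
  unfold Xor at hxy hxz hyz
  tauto

/-- `2·C(d + 1, 2) = (d + 1)·d`. -/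
theorem two_mul_choose_two_succ (d : ℕ) : 2 * (d + 1).choose 2 = (d + 1) * d := by
  rw [Nat.choose_two_right, Nat.add_sub_cancel]
  exact Nat.mul_div_cancel' (by rw [mul_comm]; exact (Nat.even_mul_succ_self d).two_dvd)

/-- **SHARPNESS:** on `K_{a, n−a}` the bound is attained: `2·cherries + 2m = m·n`. -/
theorem mantel_eq_bip (n a : ℕ) (h : a ≤ n) :
    2 * cherries (bip n a) + 2 * (bip n a).edgeFinset.card = (bip n a).edgeFinset.card * n := by
  rw [cherries_bip n a h, card_edges_bip n a h]
  obtain ⟨b, rfl⟩ := Nat.exists_eq_add_of_le h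
  rw [Nat.add_sub_cancel_left]
  cases a with
  | zero => simp
  | succ a =>
    cases b with
    | zero => simp
    | succ b =>
      have ea := two_mul_choose_two_succ a
      have eb := two_mul_choose_two_succ b
      have e : 2 * ((a + 1) * (b + 1).choose 2 + (b + 1) * (a + 1).choose 2) =
          (a + 1) * (2 * (b + 1).choose 2) + (b + 1) * (2 * (a + 1).choose 2) := by ring
      rw [e, ea, eb]
      ring

/-- The witness of the C-047 kill is extremal for the triangle-free problem: on `K_{3,25}`,
`2·975 + 2·75 = 75·28`. -/
theorem mantel_eq_K325 : 2 * cherries K325 + 2 * K325.edgeFinset.card = K325.edgeFinset.card * 28 := by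
  rw [cherries_K325, card_edges_K325]

end C047

end TriangleCap

end PercRepro
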